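import Literature.MathematicalPhysics.QuantumLattice.ApproximateEigenvectorLemmas
import HarnessLib

/-!
# The orbit basis of a symmetric-subspace certificate

Third part of the elementary toolkit for exact-diagonalisation CERTIFICATES of ground states
(`GroundStateEnclosure.lean`: Davis–Kahan for the lowest eigenvector; `GroundStateEnclosureCoordinates.lean`:
the gap hypothesis from a PSD certificate in the coordinates of an orthogonal family `b` with
`H b_j = Σ_i C_{ij} b_i`). Here the orthogonal family is made concrete as the INDICATORS OF THE
CLASSES of a partition of the basis (in practice: the orbits of a symmetry group of the Hamiltonian),
given by a class map `cls : m → ι` with chosen representatives `rep : ι → m`: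

* `orbitIndicator_dotProduct_of_ne`, `orbitIndicator_dotProduct_self` — the indicators
  `1_a = (σ ↦ [cls σ = a])` are pairwise orthogonal with `⟨1_a, 1_a⟩ = |class a|`;
* `eq_sum_smul_orbitIndicator`, `mem_span_orbitIndicator` — a class-constant vector is
  `Σ_a v(rep a) 1_a`, in particular lies in the span of the indicators (apply to the true ground
  state, which is fixed by the symmetry group, and to the trial vector);
* `mulVec_apply_eq_of_perm_invariant` — if `H` is invariant under a family of permutations `g_k` of
  the basis (`H (g σ) (g τ) = H σ τ`) and "invariant under every `g_k` ⇒ class-constant" (the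
  user's reachability certificate: every configuration is a word in the `g_k` applied to its
  representative), then `H` maps class-constant vectors to class-constant vectors;
* `mulVec_orbitIndicator_eq_sum` — hence `H 1_j = Σ_i C_{ij} 1_i` with `C_{ij} = (H 1_j)(rep i)`,
  the COUNT MATRIX (number of `H`-hops from the class `j` into the representative of class `i`,
  weighted by the matrix entries): the hypothesis `hC` of `re_form_ge_of_coordinate_certificate`,
  reduced to one evaluation per pair of classes.

Elementary (orbit-sum / "symmetric subspace" reduction of exact diagonalisation; e.g. A. W. Sandvik,
AIP Conf. Proc. 1297 (2010) 135, §4.1). No definition is introduced (indicators are explicit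
lambdas); sorry-free.
-/

noncomputable section

open Matrix Complex Finset
open scoped ComplexOrder ComplexConjugate

namespace Literature.MathematicalPhysics.QuantumLattice

variable {m : Type*} [Fintype m] {ι : Type*} [DecidableEq ι]

/-! ### Indicators of the classes: orthogonality and norms -/

/-- Indicators of distinct classes are orthogonal. [folklore] -/
theorem orbitIndicator_dotProduct_of_ne (cls : m → ι) {a a' : ι} (h : a ≠ a') :
    star (fun σ => if cls σ = a then (1 : ℂ) else 0) ⬝ᵥ (fun σ => if cls σ = a' then (1 : ℂ) else 0)
      = 0 := by
  simp only [dotProduct, Pi.star_apply]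
  refine Finset.sum_eq_zero fun σ _ => ?_
  by_cases h1 : cls σ = a
  · simp [h1, h]
  · simp [h1]

/-- The norm of a class indicator is the class size: `⟨1_a, 1_a⟩ = |{σ : cls σ = a}|`. [folklore] -/
theorem orbitIndicator_dotProduct_self (cls : m → ι) (a : ι) :
    star (fun σ => if cls σ = a then (1 : ℂ) else 0) ⬝ᵥ (fun σ => if cls σ = a then (1 : ℂ) else 0)
      = (((Finset.univ.filter fun σ => cls σ = a).card : ℕ) : ℂ) := by
  simp only [dotProduct, Pi.star_apply]
  rw [Finset.card_eq_sum_ones, Nat.cast_sum, Finset.sum_filter]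
  refine Finset.sum_congr rfl fun σ _ => ?_
  by_cases h1 : cls σ = a <;> simp [h1]

/-! ### Class-constant vectors lie in the span of the indicators -/

omit [Fintype m] in
/-- A class-constant vector is the combination `Σ_a v(rep a) · 1_a` of the class indicators.
[folklore] -/
theorem eq_sum_smul_orbitIndicator [Fintype ι] (cls : m → ι) (rep : ι → m)
    (v : m → ℂ) (hv : ∀ σ, v σ = v (rep (cls σ))) :
    v = ∑ a, v (rep a) • (fun σ => if cls σ = a then (1 : ℂ) else 0) := by
  funext σ
  rw [Finset.sum_apply]
  simp only [Pi.smul_apply, smul_eq_mul, mul_ite, mul_one, mul_zero]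
  rw [Finset.sum_ite_eq (Finset.univ) (cls σ) (fun a => v (rep a))]
  simp only [Finset.mem_univ, if_true]
  exact hv σ

omit [Fintype m] in
/-- A class-constant vector lies in the span of the class indicators. [folklore] -/
theorem mem_span_orbitIndicator [Fintype ι] (cls : m → ι) (rep : ι → m)
    (v : m → ℂ) (hv : ∀ σ, v σ = v (rep (cls σ))) :
    v ∈ Submodule.span ℂ (Set.range fun a : ι => fun σ : m => if cls σ = a then (1 : ℂ) else 0) := by
  rw [eq_sum_smul_orbitIndicator cls rep v hv]
  exact Submodule.sum_mem _ fun a _ => Submodule.smul_mem _ _ (Submodule.subset_span ⟨a, rfl⟩)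

omit [Fintype m] in
/-- The class indicators themselves are class-constant (trivially). [folklore] -/
theorem orbitIndicator_apply_eq (cls : m → ι) (rep : ι → m) (hrep : ∀ a, cls (rep a) = a) (a : ι)
    (σ : m) :
    (fun τ : m => if cls τ = a then (1 : ℂ) else 0) σ =
      (fun τ : m => if cls τ = a then (1 : ℂ) else 0) (rep (cls σ)) := by
  simp only [hrep]

/-! ### A symmetric Hamiltonian maps class-constant vectors to class-constant vectors -/

/-- **Invariance of `H` under basis permutations passes to `H v` for invariant `v`**: if
`H (g σ) (g τ) = H σ τ` for a permutation `g` and `v ∘ g = v`, then `(H v) ∘ g = H v`. [folklore] -/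
theorem mulVec_apply_perm_of_invariant (H : Matrix m m ℂ) (g : Equiv.Perm m)
    (hH : ∀ σ τ, H (g σ) (g τ) = H σ τ) (v : m → ℂ) (hv : ∀ σ, v (g σ) = v σ) (σ : m) :
    (H *ᵥ v) (g σ) = (H *ᵥ v) σ := by
  simp only [mulVec, dotProduct]
  rw [← Equiv.sum_comp g]
  refine Finset.sum_congr rfl fun τ _ => ?_
  rw [hH σ τ, hv τ]

omit [DecidableEq ι] in
/-- **`H` maps class-constant vectors to class-constant vectors.** Let `g_k` be permutations of
the basis under which `H` is invariant, and suppose that every vector invariant under all `g_k` is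
constant on the classes of `cls` with representatives `rep` (REACHABILITY: each configuration is a
word in the `g_k` applied to its representative — the user's certificate) and that the classes are
`g_k`-stable. Then for every class-constant `v`, `H v` is class-constant. [folklore] -/
theorem mulVec_apply_eq_of_perm_invariant {K : Type*} (H : Matrix m m ℂ) (g : K → Equiv.Perm m)
    (hH : ∀ k σ τ, H (g k σ) (g k τ) = H σ τ) (cls : m → ι) (rep : ι → m)
    (hcls : ∀ k σ, cls (g k σ) = cls σ)
    (hconst : ∀ v : m → ℂ, (∀ k σ, v (g k σ) = v σ) → ∀ σ, v σ = v (rep (cls σ)))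
    (v : m → ℂ) (hv : ∀ σ, v σ = v (rep (cls σ))) (σ : m) :
    (H *ᵥ v) σ = (H *ᵥ v) (rep (cls σ)) := by
  have hvg : ∀ k τ, v (g k τ) = v τ := fun k τ => by rw [hv (g k τ), hcls k τ, ← hv τ]
  exact hconst (H *ᵥ v) (fun k τ => mulVec_apply_perm_of_invariant H (g k) (hH k) v (hvg k) τ) σ

/-- **The count matrix: `H 1_j = Σ_i C_{ij} 1_i` with `C_{ij} = (H 1_j)(rep i)`.** Under the
hypotheses of `mulVec_apply_eq_of_perm_invariant`, `H` applied to a class indicator is the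
combination of class indicators whose coefficients are read off at the representatives; so if a
real matrix `C` satisfies `(H 1_j)(rep i) = C_{ij}` for all `i, j` (one evaluation per pair of classes
— for a local lattice Hamiltonian a COUNT of hops, computable in the kernel), then
`H 1_j = Σ_i C_{ij} 1_i`: the hypothesis `hC` of `re_form_ge_of_coordinate_certificate`.
[folklore] -/
theorem mulVec_orbitIndicator_eq_sum [Fintype ι] {K : Type*} (H : Matrix m m ℂ)
    (g : K → Equiv.Perm m) (hH : ∀ k σ τ, H (g k σ) (g k τ) = H σ τ) (cls : m → ι) (rep : ι → m)
    (hrep : ∀ a, cls (rep a) = a) (hcls : ∀ k σ, cls (g k σ) = cls σ)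
    (hconst : ∀ v : m → ℂ, (∀ k σ, v (g k σ) = v σ) → ∀ σ, v σ = v (rep (cls σ)))
    (C : Matrix ι ι ℝ)
    (hC : ∀ i j, (H *ᵥ fun σ => if cls σ = j then (1 : ℂ) else 0) (rep i) = (C i j : ℂ)) (j : ι) :
    (H *ᵥ fun σ => if cls σ = j then (1 : ℂ) else 0) =
      ∑ i, (C i j : ℂ) • (fun σ => if cls σ = i then (1 : ℂ) else 0) := by
  set v : m → ℂ := H *ᵥ fun σ => if cls σ = j then (1 : ℂ) else 0 with hvdef
  have hvc : ∀ σ, v σ = v (rep (cls σ)) := fun σ =>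
    mulVec_apply_eq_of_perm_invariant H g hH cls rep hcls hconst _
      (orbitIndicator_apply_eq cls rep hrep j) σ
  conv_lhs => rw [eq_sum_smul_orbitIndicator cls rep v hvc]
  refine Finset.sum_congr rfl fun i _ => ?_
  rw [hvdef, hC i j]

omit [Fintype m] [DecidableEq ι] in
/-- **Generator-invariant vectors from a reachability certificate.** If every configuration `σ`
is obtained from the representative of its class by applying a word `w σ` in the permutations
`g_k` (a list of generator indices, applied right-to-left), then every vector invariant under all
`g_k` is class-constant — the hypothesis `hconst` above, discharged once from the user's witness
function. [folklore] -/
theorem classConst_of_reachable {K : Type*} (g : K → Equiv.Perm m) (cls : m → ι) (rep : ι → m)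
    (w : m → List K) (hw : ∀ σ, ((w σ).foldr (fun k τ => g k τ) (rep (cls σ))) = σ)
    (v : m → ℂ) (hv : ∀ k σ, v (g k σ) = v σ) (σ : m) :
    v σ = v (rep (cls σ)) := by
  have key : ∀ (l : List K) (τ : m), v (l.foldr (fun k τ => g k τ) τ) = v τ := by
    intro l
    induction l with
    | nil => intro τ; rfl
    | cons k l ih => intro τ; rw [List.foldr_cons, hv k, ih τ]
  conv_lhs => rw [← hw σ]
  exact key (w σ) (rep (cls σ))

end Literature.MathematicalPhysics.QuantumLattice

end
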